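import Mathlib
import Literature.Combinatorics.Additive.TPPGroupAlgebra
import Summits.MatrixMultiplication.MatrixMultiplication.Theorems.SnSubsetDichotomyPolynomialSlackCollisionFloor

/-!
# Every member of a TPP triple beating the wall is level-one biased (solved form of the collision floor)

Crux `Summit.MatrixMultiplication.MatrixMultiplication.Theses.SnSubsetDichotomy.PolynomialSlack`
(item `stmt-MatrixMultiplication-8306`), level-one programme, lead c5 (wave 3). From `collisionFloor`
(`2N − n! − n!√(n!)/√D ≤ ((n−1)/4)·N·‖Δ_U‖_F²`, `D = n(n−1)/6`) and its two rotations: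

* `memberEnergy_ge_of_beating_wall` — for `n ≥ 40`, a parity-pure TPP triple `S, T, U ⊆ S_n` with
  `n! + n!√(n!)/√D ≤ N = |S||T||U|` has `‖Δ_X‖_F² = Σ_{v,q} (c_X(q→v)/|X| − 1/n)² ≥ 4/(n−1)` for EACH of
  its three members `X ∈ {S, T, U}`: two random elements of any member agree in at least `1 + 4/(n−1)`
  positions on average (a random set of the same size has `‖Δ_X‖² ≈ n/|X| ≈ 0`). In the crux regime
  `N = (n!)^{3/2}/n^C`, `C < 1`, the hypothesis holds for all large `n`.
-/

namespace Summit.MatrixMultiplication.MatrixMultiplication.Theorems.PolynomialSlack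

open scoped BigOperators
open Literature.Combinatorics.Additive (TripleProductProperty)

set_option linter.dupNamespace false

/-- Solved form of `collisionFloor` for the third member: beating the wall forces
`Σ_{v,q} (c_U(q→v)/|U| − 1/n)² ≥ 4/(n−1)`. [folklore] -/
theorem thirdMemberEnergy_ge_of_beating_wall {n : ℕ} (hn : 40 ≤ n) {S T U : Finset (Equiv.Perm (Fin n))}
    (hTPP : TripleProductProperty S T U)
    (hS : ∀ s ∈ S, ∀ s' ∈ S, Equiv.Perm.sign s = Equiv.Perm.sign s')
    (hT : ∀ t ∈ T, ∀ t' ∈ T, Equiv.Perm.sign t = Equiv.Perm.sign t')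
    (hU : ∀ u ∈ U, ∀ u' ∈ U, Equiv.Perm.sign u = Equiv.Perm.sign u')
    (hwall : (n.factorial : ℝ) +
        (n.factorial : ℝ) * Real.sqrt (n.factorial : ℝ) / Real.sqrt (((n * (n - 1) : ℕ) : ℝ) / 6) ≤
      ((S.card * T.card * U.card : ℕ) : ℝ)) :
    4 / ((n : ℝ) - 1) ≤
      ∑ v : Fin n, ∑ q : Fin n, (((U.filter fun u => u q = v).card : ℝ) / U.card - 1 / n) ^ 2 := by
  have h := collisionFloor n hn S T U hTPP hS hT hU
  set P : ℝ := ((S.card * T.card * U.card : ℕ) : ℝ) with hP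
  set E : ℝ := ∑ v : Fin n, ∑ q : Fin n,
    (((U.filter fun u => u q = v).card : ℝ) / U.card - 1 / n) ^ 2 with hE
  have hm : (0 : ℝ) < (n : ℝ) - 1 := by
    have : (40 : ℝ) ≤ n := by exact_mod_cast hn
    linarith
  have hF0 : (0 : ℝ) < n.factorial := by exact_mod_cast n.factorial_pos
  have hextra : 0 ≤ (n.factorial : ℝ) * Real.sqrt (n.factorial : ℝ) /
      Real.sqrt (((n * (n - 1) : ℕ) : ℝ) / 6) := by positivity
  have hP0 : 0 < P := by rw [hP]; linarith
  -- `P ≤ 2P − n! − extra ≤ ((n−1)/4)·P·E`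
  have h1 : P ≤ ((n : ℝ) - 1) / 4 * P * E := by linarith
  have h2 : 1 ≤ ((n : ℝ) - 1) / 4 * E := by
    have e : ((n : ℝ) - 1) / 4 * P * E = P * (((n : ℝ) - 1) / 4 * E) := by ring
    rw [e] at h1
    by_contra hlt
    rw [not_le] at hlt
    have : P * (((n : ℝ) - 1) / 4 * E) < P * 1 := mul_lt_mul_of_pos_left hlt hP0
    linarith
  rw [div_le_iff₀ hm]
  linarith

/-- **Every member of a TPP triple beating the wall is level-one biased.** For `n ≥ 40` and a
parity-pure TPP triple `S, T, U ⊆ S_n` with `n! + n!√(n!)/√(n(n−1)/6) ≤ |S||T||U|`, each member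
`X ∈ {S, T, U}` satisfies `Σ_{v,q} (c_X(q→v)/|X| − 1/n)² ≥ 4/(n−1)` (`collisionFloor` applied to the
three rotations of the triple). [folklore] -/
theorem memberEnergy_ge_of_beating_wall {n : ℕ} (hn : 40 ≤ n) {S T U : Finset (Equiv.Perm (Fin n))}
    (hTPP : TripleProductProperty S T U)
    (hS : ∀ s ∈ S, ∀ s' ∈ S, Equiv.Perm.sign s = Equiv.Perm.sign s')
    (hT : ∀ t ∈ T, ∀ t' ∈ T, Equiv.Perm.sign t = Equiv.Perm.sign t')
    (hU : ∀ u ∈ U, ∀ u' ∈ U, Equiv.Perm.sign u = Equiv.Perm.sign u')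
    (hwall : (n.factorial : ℝ) +
        (n.factorial : ℝ) * Real.sqrt (n.factorial : ℝ) / Real.sqrt (((n * (n - 1) : ℕ) : ℝ) / 6) ≤
      ((S.card * T.card * U.card : ℕ) : ℝ)) :
    4 / ((n : ℝ) - 1) ≤
        ∑ v : Fin n, ∑ q : Fin n, (((S.filter fun s => s q = v).card : ℝ) / S.card - 1 / n) ^ 2 ∧
      4 / ((n : ℝ) - 1) ≤
        ∑ v : Fin n, ∑ q : Fin n, (((T.filter fun t => t q = v).card : ℝ) / T.card - 1 / n) ^ 2 ∧
      4 / ((n : ℝ) - 1) ≤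
        ∑ v : Fin n, ∑ q : Fin n, (((U.filter fun u => u q = v).card : ℝ) / U.card - 1 / n) ^ 2 := by
  refine ⟨?_, ?_, thirdMemberEnergy_ge_of_beating_wall hn hTPP hS hT hU hwall⟩
  · -- rotate `(S,T,U) ↦ (T,U,S)`
    have hw : (n.factorial : ℝ) +
        (n.factorial : ℝ) * Real.sqrt (n.factorial : ℝ) / Real.sqrt (((n * (n - 1) : ℕ) : ℝ) / 6) ≤
        ((T.card * U.card * S.card : ℕ) : ℝ) := by
      have e : T.card * U.card * S.card = S.card * T.card * U.card := by ring
      rw [e]; exact hwall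
    exact thirdMemberEnergy_ge_of_beating_wall hn hTPP.rotate hT hU hS hw
  · -- rotate twice `(S,T,U) ↦ (U,S,T)`
    have hw : (n.factorial : ℝ) +
        (n.factorial : ℝ) * Real.sqrt (n.factorial : ℝ) / Real.sqrt (((n * (n - 1) : ℕ) : ℝ) / 6) ≤
        ((U.card * S.card * T.card : ℕ) : ℝ) := by
      have e : U.card * S.card * T.card = S.card * T.card * U.card := by ring
      rw [e]; exact hwall
    exact thirdMemberEnergy_ge_of_beating_wall hn hTPP.rotate.rotate hU hS hT hw

end Summit.MatrixMultiplication.MatrixMultiplication.Theorems.PolynomialSlack
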